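import Literature.Analysis.PDE.CoordWordDeriv
import Mathlib.MeasureTheory.Function.L2Space
import Mathlib.Analysis.Normed.Module.FiniteDimension
import HarnessLib

/-!
# Tame `L²` estimates for word derivatives of nonlinear compositions `x ↦ F(x, h(x))`

Analytic layer of the energy-method programme for short-time existence of quasilinear strictly
parabolic second-order systems on a closed manifold (hypothesis `hQL` of
`Literature.Geometry.Riemannian.ricciFlow_shortTime_existence_of_quasilinear`; Hamilton 1982,
§5; Taylor, *PDE III*, Ch. 15, §7). The commutator terms of Gårding's inequality at Sobolev
level `s` for a quasilinear operator `a(x, u, Du) ∂²u + f(x, u, Du)` are word derivatives of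
compositions `x ↦ F(x, h(x))` of a smooth nonlinearity `F` with the jet `h = (u, Du)`. This file
proves the two classical bounds on such derivatives on a compact set `K` (Taylor, *PDE III*,
Ch. 13, §3, Props. 3.7–3.9 in the crude form that needs no Gagliardo–Nirenberg interpolation,
valid once all but the highest factor of every Leibniz term can be taken in the sup norm):

* `exists_sup_bound_cwd_comp` — **sup bounds**: for `F` smooth on `ℝⁿ × J`, `K` compact and
  `m`, `R` given, there is `C` such that `‖∂_v [F(·, h)]‖ ≤ C` on `K` for all `|v| ≤ m` whenever
  `h` is smooth with `‖∂_c h‖ ≤ R` on `K` for `|c| ≤ m`;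
* `exists_tame_bound_cwd_comp` — **tame `L²(K)` bounds**: there is `C` such that
  `‖𝟙_K ∂_v [F(·, h)]‖_{L²} ≤ C (1 + Y)` for all `|v| ≤ m` whenever `‖∂_c h‖ ≤ R` on `K` for
  `|c| ≤ m / 2 + 1` and `‖𝟙_K ∂_c h‖_{L²} ≤ Y` for `|c| ≤ m` — LINEAR in the top-order `L²`
  quantity `Y`, with constants depending on sup norms of `h` of roughly half the order only.

Both are proved by induction on `m` through the one-step chain rule
`∂_i [F(x, h x)] = (∂_x F)(x, h x) 𝐞ᵢ + (∂_p F)(x, h x) (∂_i h x)` (`fderiv_comp_graph_apply`), the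
Leibniz expansion over splittings (`cwd_bilinear`, `CoordWordDeriv.lean`) of the second,
bilinear, term, and the dichotomy "the factor with fewer derivatives goes in the sup norm". The
`L²` bookkeeping is done with the real-valued functional `l2On K f = ‖𝟙_K f‖_{L²}`
(`= (eLpNorm (K.indicator f) 2 volume).toReal`) and its elementary calculus (triangle and
Cauchy–Schwarz inequalities through Mathlib's Hilbert space `Lp W 2`).

Everything is proved; no named fact and no `sorry` is introduced.

## References

* M. E. Taylor, *Partial differential equations III. Nonlinear equations*, 2nd ed., Springer 2011,
  Ch. 13, §3 (Props. 3.7–3.9, Moser-type estimates). [TaylorPDEIII2011]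
* L. C. Evans, *Partial Differential Equations*, 2nd ed., AMS 2010, §5.2.3. [Evans2010]
-/

noncomputable section

open MeasureTheory Set Function Filter
open scoped ContDiff Topology RealInnerProductSpace ENNReal

namespace Literature.Analysis.PDE

open Literature.Analysis.FunctionSpaces

universe u

variable {ι : Type*} [Fintype ι] [DecidableEq ι]

/-! ### The functional `‖𝟙_K f‖_{L²}` -/

section L2On

variable {F : Type*} [NormedAddCommGroup F]

/-- `l2On K f = ‖𝟙_K f‖_{L²(ℝⁿ)}` as a real number (`(eLpNorm (K.indicator f) 2 volume).toReal`;
junk value `0` if infinite, which never happens for continuous `f` and compact `K`).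
[folklore] -/
def l2On (K : Set (EuclideanSpace ℝ ι)) (f : EuclideanSpace ℝ ι → F) : ℝ :=
  (eLpNorm (K.indicator f) 2 (volume : Measure (EuclideanSpace ℝ ι))).toReal

omit [DecidableEq ι] in
/-- Unfolding of `l2On`. [folklore] -/
theorem l2On_def (K : Set (EuclideanSpace ℝ ι)) (f : EuclideanSpace ℝ ι → F) :
    l2On K f = (eLpNorm (K.indicator f) 2 (volume : Measure (EuclideanSpace ℝ ι))).toReal := rfl

omit [DecidableEq ι] in
/-- `0 ≤ l2On K f`. [folklore] -/
theorem l2On_nonneg (K : Set (EuclideanSpace ℝ ι)) (f : EuclideanSpace ℝ ι → F) :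
    0 ≤ l2On K f := ENNReal.toReal_nonneg

omit [DecidableEq ι] in
/-- `‖𝟙_K f‖_{L²} = ‖f‖_{L²(K)}` (indicator versus restriction). [folklore] -/
theorem eLpNorm_indicator_eq_restrict {K : Set (EuclideanSpace ℝ ι)} (hK : MeasurableSet K)
    (f : EuclideanSpace ℝ ι → F) :
    eLpNorm (K.indicator f) 2 (volume : Measure (EuclideanSpace ℝ ι)) =
      eLpNorm f 2 ((volume : Measure (EuclideanSpace ℝ ι)).restrict K) :=
  eLpNorm_indicator_eq_eLpNorm_restrict hK

omit [DecidableEq ι] in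
/-- **Sup bound**: if `‖f‖ ≤ C` on a compact `K` then `‖𝟙_K f‖_{L²} ≤ vol(K)^{1/2} C`, in the
`ℝ≥0∞` form. [folklore] -/
theorem eLpNorm_indicator_le_of_bound {K : Set (EuclideanSpace ℝ ι)} (hK : IsCompact K)
    {f : EuclideanSpace ℝ ι → F} {C : ℝ} (hC : ∀ x ∈ K, ‖f x‖ ≤ C) :
    eLpNorm (K.indicator f) 2 (volume : Measure (EuclideanSpace ℝ ι)) ≤
      (volume K) ^ (2 : ℝ)⁻¹ * ENNReal.ofReal C := by
  rw [eLpNorm_indicator_eq_restrict hK.measurableSet]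
  have h := eLpNorm_le_of_ae_bound (p := (2 : ℝ≥0∞)) (μ := (volume : Measure _).restrict K)
    (f := f) (C := C) ((ae_restrict_iff' hK.measurableSet).2 (Eventually.of_forall hC))
  simpa [Measure.restrict_apply_univ] using h

omit [DecidableEq ι] in
/-- For continuous `f` and compact `K`, `‖𝟙_K f‖_{L²} < ∞`. [folklore] -/
theorem eLpNorm_indicator_lt_top {K : Set (EuclideanSpace ℝ ι)} (hK : IsCompact K)
    {f : EuclideanSpace ℝ ι → F} (hf : Continuous f) :
    eLpNorm (K.indicator f) 2 (volume : Measure (EuclideanSpace ℝ ι)) < ⊤ := by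
  obtain ⟨C, hC⟩ := hK.exists_bound_of_continuousOn hf.continuousOn
  refine (eLpNorm_indicator_le_of_bound hK hC).trans_lt ?_
  exact ENNReal.mul_lt_top (ENNReal.rpow_lt_top_of_nonneg (by norm_num : (0 : ℝ) ≤ 2⁻¹) hK.measure_lt_top.ne)
    ENNReal.ofReal_lt_top

omit [DecidableEq ι] in
/-- For continuous `f` and compact `K`, `𝟙_K f ∈ L²`. [folklore] -/
theorem memLp_indicator {K : Set (EuclideanSpace ℝ ι)} (hK : IsCompact K)
    {f : EuclideanSpace ℝ ι → F} (hf : Continuous f) :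
    MemLp (K.indicator f) 2 (volume : Measure (EuclideanSpace ℝ ι)) :=
  ⟨(hf.aestronglyMeasurable.indicator hK.measurableSet), eLpNorm_indicator_lt_top hK hf⟩

omit [DecidableEq ι] in
/-- **Sup bound, real form**: `‖𝟙_K f‖_{L²} ≤ vol(K)^{1/2} C` if `‖f‖ ≤ C` on `K`, `0 ≤ C`.
[folklore] -/
theorem l2On_le_of_bound {K : Set (EuclideanSpace ℝ ι)} (hK : IsCompact K)
    {f : EuclideanSpace ℝ ι → F} {C : ℝ} (hC0 : 0 ≤ C) (hC : ∀ x ∈ K, ‖f x‖ ≤ C) :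
    l2On K f ≤ ((volume K) ^ (2 : ℝ)⁻¹).toReal * C := by
  rw [l2On_def]
  have h := eLpNorm_indicator_le_of_bound hK hC
  have hfin : (volume K) ^ (2 : ℝ)⁻¹ * ENNReal.ofReal C ≠ ⊤ :=
    ENNReal.mul_ne_top (ENNReal.rpow_lt_top_of_nonneg (by norm_num : (0 : ℝ) ≤ 2⁻¹) hK.measure_lt_top.ne).ne
      ENNReal.ofReal_ne_top
  calc (eLpNorm (K.indicator f) 2 volume).toReal
      ≤ ((volume K) ^ (2 : ℝ)⁻¹ * ENNReal.ofReal C).toReal := ENNReal.toReal_mono hfin h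
    _ = ((volume K) ^ (2 : ℝ)⁻¹).toReal * C := by rw [ENNReal.toReal_mul, ENNReal.toReal_ofReal hC0]

omit [DecidableEq ι] in
/-- **Pointwise domination**: if `‖f‖ ≤ c ‖g‖` on `K` with `g` continuous, then
`‖𝟙_K f‖_{L²} ≤ c ‖𝟙_K g‖_{L²}`. [folklore] -/
theorem l2On_le_mul_of_le {K : Set (EuclideanSpace ℝ ι)} (hK : IsCompact K)
    {G : Type*} [NormedAddCommGroup G] {f : EuclideanSpace ℝ ι → F} {g : EuclideanSpace ℝ ι → G}
    (hg : Continuous g) {c : ℝ} (hc : 0 ≤ c) (h : ∀ x ∈ K, ‖f x‖ ≤ c * ‖g x‖) :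
    l2On K f ≤ c * l2On K g := by
  rw [l2On_def, l2On_def]
  have hpt : ∀ x, ‖K.indicator f x‖ ≤ c * ‖K.indicator g x‖ := fun x => by
    by_cases hx : x ∈ K
    · rw [indicator_of_mem hx, indicator_of_mem hx]; exact h x hx
    · rw [indicator_of_notMem hx, indicator_of_notMem hx]; simp
  have h1 := eLpNorm_le_mul_eLpNorm_of_ae_le_mul (p := (2 : ℝ≥0∞))
    (μ := (volume : Measure (EuclideanSpace ℝ ι))) (Eventually.of_forall hpt)
  have hfin : ENNReal.ofReal c * eLpNorm (K.indicator g) 2 volume ≠ ⊤ :=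
    ENNReal.mul_ne_top ENNReal.ofReal_ne_top (eLpNorm_indicator_lt_top hK hg).ne
  calc (eLpNorm (K.indicator f) 2 volume).toReal
      ≤ (ENNReal.ofReal c * eLpNorm (K.indicator g) 2 volume).toReal := ENNReal.toReal_mono hfin h1
    _ = c * (eLpNorm (K.indicator g) 2 volume).toReal := by
        rw [ENNReal.toReal_mul, ENNReal.toReal_ofReal hc]

omit [DecidableEq ι] in
/-- **Triangle inequality**: `‖𝟙_K (f + g)‖_{L²} ≤ ‖𝟙_K f‖_{L²} + ‖𝟙_K g‖_{L²}` for continuous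
`f, g` and compact `K`. [folklore] -/
theorem l2On_add_le {K : Set (EuclideanSpace ℝ ι)} (hK : IsCompact K)
    {f g : EuclideanSpace ℝ ι → F} (hf : Continuous f) (hg : Continuous g) :
    l2On K (fun x => f x + g x) ≤ l2On K f + l2On K g := by
  rw [l2On_def, l2On_def, l2On_def]
  have hadd : K.indicator (fun x => f x + g x) = K.indicator f + K.indicator g := by
    funext x
    by_cases hx : x ∈ K <;> simp [hx]
  rw [hadd, ← ENNReal.toReal_add (eLpNorm_indicator_lt_top hK hf).ne
    (eLpNorm_indicator_lt_top hK hg).ne]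
  exact ENNReal.toReal_mono (ENNReal.add_ne_top.2 ⟨(eLpNorm_indicator_lt_top hK hf).ne,
    (eLpNorm_indicator_lt_top hK hg).ne⟩)
    (eLpNorm_add_le (hf.aestronglyMeasurable.indicator hK.measurableSet)
      (hg.aestronglyMeasurable.indicator hK.measurableSet) one_le_two)

omit [DecidableEq ι] in
/-- **Triangle inequality for list sums** of continuous functions on a compact set. [folklore] -/
theorem l2On_list_sum_le {K : Set (EuclideanSpace ℝ ι)} (hK : IsCompact K) {κ : Type*}
    (l : List κ) {φ : κ → EuclideanSpace ℝ ι → F} (hφ : ∀ k ∈ l, Continuous (φ k)) :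
    l2On K (fun x => (l.map fun k => φ k x).sum) ≤ (l.map fun k => l2On K (φ k)).sum := by
  induction l with
  | nil =>
    simp only [List.map_nil, List.sum_nil]
    rw [l2On_def]
    simp
  | cons k l ih =>
    have hk : Continuous (φ k) := hφ k List.mem_cons_self
    have hl : ∀ k' ∈ l, Continuous (φ k') := fun k' hk' => hφ k' (List.mem_cons_of_mem _ hk')
    have hs : Continuous (fun x => (l.map fun k' => φ k' x).sum) := continuous_list_sum l hl
    simp only [List.map_cons, List.sum_cons]
    exact (l2On_add_le hK hk hs).trans (by gcongr; exact ih hl)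

variable {W : Type*} [NormedAddCommGroup W] [InnerProductSpace ℝ W]

omit [DecidableEq ι] in
/-- **Cauchy–Schwarz for the `L²` pairing**: `|∫ ⟪f, g⟫| ≤ ‖f‖_{L²} ‖g‖_{L²}` for `f, g ∈ L²`
(through Mathlib's Hilbert space `Lp W 2`). [folklore] -/
theorem abs_integral_inner_le_of_memLp {f g : EuclideanSpace ℝ ι → W}
    (hf : MemLp f 2 (volume : Measure (EuclideanSpace ℝ ι)))
    (hg : MemLp g 2 (volume : Measure (EuclideanSpace ℝ ι))) :
    |∫ x, ⟪f x, g x⟫| ≤ (eLpNorm f 2 (volume : Measure (EuclideanSpace ℝ ι))).toReal *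
      (eLpNorm g 2 (volume : Measure (EuclideanSpace ℝ ι))).toReal := by
  have h1 : ⟪hf.toLp f, hg.toLp g⟫ = ∫ x, ⟪f x, g x⟫ := by
    rw [L2.inner_def]
    refine integral_congr_ae ?_
    filter_upwards [hf.coeFn_toLp, hg.coeFn_toLp] with x hfx hgx
    rw [hfx, hgx]
  rw [← h1, ← Lp.norm_toLp f hf, ← Lp.norm_toLp g hg]
  exact abs_real_inner_le_norm _ _

omit [DecidableEq ι] in
/-- **Cauchy–Schwarz on a compact set**: if `g` vanishes off `K` then
`|∫ ⟪f, g⟫| ≤ ‖𝟙_K f‖_{L²} ‖𝟙_K g‖_{L²}` for continuous `f, g`. [folklore] -/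
theorem abs_integral_inner_le_l2On {K : Set (EuclideanSpace ℝ ι)} (hK : IsCompact K)
    {f g : EuclideanSpace ℝ ι → W} (hf : Continuous f) (hg : Continuous g)
    (hgK : ∀ x, x ∉ K → g x = 0) :
    |∫ x, ⟪f x, g x⟫| ≤ l2On K f * l2On K g := by
  have heq : (fun x => ⟪f x, g x⟫) = fun x => ⟪K.indicator f x, K.indicator g x⟫ := by
    funext x
    by_cases hx : x ∈ K
    · rw [indicator_of_mem hx, indicator_of_mem hx]
    · rw [indicator_of_notMem hx, indicator_of_notMem hx, hgK x hx]
      simp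
  rw [heq, l2On_def, l2On_def]
  exact abs_integral_inner_le_of_memLp (memLp_indicator hK hf) (memLp_indicator hK hg)

end L2On

/-! ### The one-step chain rule for `x ↦ F(x, h x)` -/

section Chain

variable {J : Type*} [NormedAddCommGroup J] [NormedSpace ℝ J]
variable {G : Type*} [NormedAddCommGroup G] [NormedSpace ℝ G]

/-- The `x`-derivative of `F` along `𝐞ᵢ` at frozen second argument:
`dX F i (x, p) = DF(x, p)(𝐞ᵢ, 0)`. [folklore] -/
def dX (F : EuclideanSpace ℝ ι × J → G) (i : ι) : EuclideanSpace ℝ ι × J → G :=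
  fun z => fderiv ℝ F z (bv i, 0)

/-- The partial derivative of `F` in the second variable as a map into `J →L G`:
`dP F (x, p) = DF(x, p) ∘ inr`. [folklore] -/
def dP (F : EuclideanSpace ℝ ι × J → G) : EuclideanSpace ℝ ι × J → (J →L[ℝ] G) :=
  fun z => (fderiv ℝ F z).comp (ContinuousLinearMap.inr ℝ (EuclideanSpace ℝ ι) J)

omit [DecidableEq ι] in
/-- `dX F i` is smooth if `F` is. [folklore] -/
theorem contDiff_dX {F : EuclideanSpace ℝ ι × J → G} (hF : ContDiff ℝ ∞ F) (i : ι) :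
    ContDiff ℝ ∞ (dX F i) :=
  (hF.fderiv_right (m := ∞) (by norm_cast)).clm_apply contDiff_const

omit [DecidableEq ι] in
/-- `dP F` is smooth if `F` is. [folklore] -/
theorem contDiff_dP {F : EuclideanSpace ℝ ι × J → G} (hF : ContDiff ℝ ∞ F) :
    ContDiff ℝ ∞ (dP F) :=
  (hF.fderiv_right (m := ∞) (by norm_cast)).clm_comp contDiff_const

omit [DecidableEq ι] in
/-- The composition `x ↦ F(x, h x)` of smooth maps is smooth. [folklore] -/
theorem contDiff_comp_graph {F : EuclideanSpace ℝ ι × J → G} (hF : ContDiff ℝ ∞ F)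
    {h : EuclideanSpace ℝ ι → J} (hh : ContDiff ℝ ∞ h) : ContDiff ℝ ∞ fun x => F (x, h x) :=
  hF.comp (contDiff_id.prodMk hh)

omit [DecidableEq ι] in
/-- **One-step chain rule**: `∂_i [F(x, h x)] = dX F i (x, h x) + dP F (x, h x) (∂_i h x)`.
[folklore] -/
theorem fderiv_comp_graph_apply {F : EuclideanSpace ℝ ι × J → G} (hF : ContDiff ℝ ∞ F)
    {h : EuclideanSpace ℝ ι → J} (hh : ContDiff ℝ ∞ h) (x : EuclideanSpace ℝ ι) (i : ι) :
    fderiv ℝ (fun y => F (y, h y)) x (bv i) =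
      dX F i (x, h x) + dP F (x, h x) (fderiv ℝ h x (bv i)) := by
  have hF' : DifferentiableAt ℝ F (x, h x) := (hF.differentiable (by simp)) _
  have hh' : DifferentiableAt ℝ h x := (hh.differentiable (by simp)) x
  have hc : HasFDerivAt (fun y => F (y, h y))
      ((fderiv ℝ F (x, h x)).comp ((ContinuousLinearMap.id ℝ _).prod (fderiv ℝ h x))) x :=
    hF'.hasFDerivAt.comp x ((hasFDerivAt_id x).prodMk hh'.hasFDerivAt)
  rw [hc.fderiv]
  simp only [dX, dP, ContinuousLinearMap.coe_comp, Function.comp_apply,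
    ContinuousLinearMap.prod_apply, ContinuousLinearMap.coe_id', id_eq,
    ContinuousLinearMap.inr_apply]
  rw [← map_add]
  congr 1
  simp

omit [DecidableEq ι] in
/-- The one-step chain rule as an identity of functions, the second term written through the
continuous bilinear "application" map `B = id : (J →L G) →L (J →L G)`. [folklore] -/
theorem cwd_singleton_comp_graph {F : EuclideanSpace ℝ ι × J → G} (hF : ContDiff ℝ ∞ F)
    {h : EuclideanSpace ℝ ι → J} (hh : ContDiff ℝ ∞ h) (i : ι) :
    cwd [i] (fun y => F (y, h y)) = fun x => dX F i (x, h x) +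
      (ContinuousLinearMap.id ℝ (J →L[ℝ] G)) (dP F (x, h x)) (cwd [i] h x) := by
  funext x
  simp only [cwd_singleton, ContinuousLinearMap.id_apply]
  exact fderiv_comp_graph_apply hF hh x i

end Chain

/-! ### Sup bounds for word derivatives of `F(x, h x)` -/

/-- Norm of a list sum is at most the sum of the norms. [folklore] -/
theorem norm_list_sum_le {G : Type*} [SeminormedAddCommGroup G] (l : List G) :
    ‖l.sum‖ ≤ (l.map fun x => ‖x‖).sum := by
  induction l with
  | nil => simp
  | cons a l ih =>
    simp only [List.sum_cons, List.map_cons]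
    exact (norm_add_le _ _).trans (by gcongr)

omit [Fintype ι] [DecidableEq ι] in
/-- The number of splittings of a word of length `k` is `2^k`. [folklore] -/
theorem length_splittings (v : List ι) : (splittings v).length = 2 ^ v.length := by
  induction v with
  | nil => rfl
  | cons j v ihv =>
    rw [splittings_cons, List.length_flatMap]
    simp only [List.length_cons, List.length_nil, List.map_const', List.sum_replicate,
      smul_eq_mul, pow_succ, ihv]

section Sup

variable {J : Type u} [NormedAddCommGroup J] [NormedSpace ℝ J] [FiniteDimensional ℝ J]

omit [Fintype ι] [DecidableEq ι] in
/-- Order zero: a smooth (hence continuous) `F` is bounded on `K × closedBall 0 R`, so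
`‖F(x, h x)‖ ≤ C` on `K` whenever `‖h‖ ≤ R` on `K`. [folklore] -/
theorem exists_sup_bound_comp_graph_zero {G : Type u} [NormedAddCommGroup G] [NormedSpace ℝ G]
    {F : EuclideanSpace ℝ ι × J → G} (hF : Continuous F) {K : Set (EuclideanSpace ℝ ι)}
    (hK : IsCompact K) (R : ℝ) :
    ∃ C : ℝ, 0 ≤ C ∧ ∀ h : EuclideanSpace ℝ ι → J, (∀ x ∈ K, ‖h x‖ ≤ R) →
      ∀ x ∈ K, ‖F (x, h x)‖ ≤ C := by
  have hc : IsCompact (K ×ˢ Metric.closedBall (0 : J) R) :=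
    hK.prod (isCompact_closedBall 0 R)
  obtain ⟨C, hC⟩ := hc.exists_bound_of_continuousOn hF.continuousOn
  refine ⟨max C 0, le_max_right _ _, fun h hh x hx => (hC (x, h x) ⟨hx, ?_⟩).trans (le_max_left _ _)⟩
  simpa using hh x hx

omit [DecidableEq ι] in
/-- **Sup bounds for word derivatives of a composition** (Taylor, *PDE III*, Ch. 13, §3, the
qualitative part of the Moser estimates): for `F` smooth on `ℝⁿ × J` (`J` finite-dimensional),
`K` compact, an order `m` and a radius `R` there is `C ≥ 0` such that
`‖∂_v [F(·, h)] (x)‖ ≤ C` for all `x ∈ K`, `|v| ≤ m`, and all smooth `h` with `‖∂_c h‖ ≤ R` on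
`K` for `|c| ≤ m`. [cite: TaylorPDEIII2011, Ch. 13, §3, Prop. 3.9] -/
theorem exists_sup_bound_cwd_comp (m : ℕ) :
    ∀ {G : Type u} [NormedAddCommGroup G] [NormedSpace ℝ G] {F : EuclideanSpace ℝ ι × J → G},
      ContDiff ℝ ∞ F → ∀ {K : Set (EuclideanSpace ℝ ι)}, IsCompact K → ∀ R : ℝ,
      ∃ C : ℝ, 0 ≤ C ∧ ∀ h : EuclideanSpace ℝ ι → J, ContDiff ℝ ∞ h →
        (∀ c : List ι, c.length ≤ m → ∀ x ∈ K, ‖cwd c h x‖ ≤ R) →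
        ∀ v : List ι, v.length ≤ m → ∀ x ∈ K, ‖cwd v (fun y => F (y, h y)) x‖ ≤ C := by
  induction m with
  | zero =>
    intro G _ _ F hF K hK R
    obtain ⟨C, hC0, hC⟩ := exists_sup_bound_comp_graph_zero hF.continuous hK R
    refine ⟨C, hC0, fun h _ hh v hv x hx => ?_⟩
    have hv0 : v = [] := List.eq_nil_of_length_eq_zero (Nat.le_zero.1 hv)
    subst hv0
    exact hC h (fun y hy => by simpa using hh [] (le_refl 0) y hy) x hx
  | succ m ih =>
    intro G _ _ F hF K hK R
    -- work with the nonnegative radius `Rp = max R 0`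
    set Rp : ℝ := max R 0 with hRpdef
    have hRp : 0 ≤ Rp := le_max_right _ _
    -- bounds for the two pieces of the one-step chain rule, at order `m`
    obtain ⟨C₀, hC₀0, hC₀⟩ := ih hF hK Rp
    have hX : ∀ i : ι, ∃ C : ℝ, 0 ≤ C ∧ ∀ h : EuclideanSpace ℝ ι → J, ContDiff ℝ ∞ h →
        (∀ c : List ι, c.length ≤ m → ∀ x ∈ K, ‖cwd c h x‖ ≤ Rp) →
        ∀ v : List ι, v.length ≤ m → ∀ x ∈ K, ‖cwd v (fun y => dX F i (y, h y)) x‖ ≤ C :=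
      fun i => ih (contDiff_dX hF i) hK Rp
    obtain ⟨C₂, hC₂0, hC₂⟩ := ih (contDiff_dP hF) hK Rp
    choose C₁ hC₁0 hC₁ using hX
    have hsum0 : 0 ≤ ∑ i, C₁ i := Finset.sum_nonneg fun i _ => hC₁0 i
    -- the constant
    refine ⟨C₀ + (∑ i, C₁ i) + 2 ^ m * (C₂ * Rp), by positivity, ?_⟩
    intro h hh hbd' v hv x hx
    have hbd : ∀ c : List ι, c.length ≤ m + 1 → ∀ x ∈ K, ‖cwd c h x‖ ≤ Rp :=
      fun c hc x hx => (hbd' c hc x hx).trans (le_max_left _ _)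
    have hbdm : ∀ c : List ι, c.length ≤ m → ∀ x ∈ K, ‖cwd c h x‖ ≤ Rp :=
      fun c hc => hbd c (hc.trans (Nat.le_succ m))
    -- split off the innermost letter
    rcases v.eq_nil_or_concat with rfl | ⟨v, i, rfl⟩
    · -- `v = []`
      have h0 := hC₀ h hh hbdm [] (Nat.zero_le _) x hx
      have h2 : 0 ≤ 2 ^ m * (C₂ * Rp) := by positivity
      linarith
    · simp only [List.concat_eq_append, List.length_append, List.length_singleton,
        Nat.succ_le_succ_iff] at hv ⊢
      rw [cwd_append_singleton]
      have hsplit : (fun y => fderiv ℝ (fun z => F (z, h z)) y (bv i)) =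
          fun y => dX F i (y, h y) +
            (ContinuousLinearMap.id ℝ (J →L[ℝ] G)) (dP F (y, h y)) (cwd [i] h y) := by
        have := cwd_singleton_comp_graph hF hh i
        rwa [cwd_singleton] at this
      rw [hsplit]
      have hA : ContDiff ℝ ∞ fun y => dX F i (y, h y) := contDiff_comp_graph (contDiff_dX hF i) hh
      have hP : ContDiff ℝ ∞ fun y => dP F (y, h y) := contDiff_comp_graph (contDiff_dP hF) hh
      have hci : ContDiff ℝ ∞ (cwd [i] h) := contDiff_cwd hh [i]
      have hB : ContDiff ℝ ∞ fun y =>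
          (ContinuousLinearMap.id ℝ (J →L[ℝ] G)) (dP F (y, h y)) (cwd [i] h y) :=
        contDiff_bilinear_apply _ hP hci
      rw [cwd_fun_add hA hB, cwd_bilinear _ hP hci]
      -- first piece
      have e1 : ‖cwd v (fun y => dX F i (y, h y)) x‖ ≤ C₁ i := hC₁ i h hh hbdm v hv x hx
      have e1' : ‖cwd v (fun y => dX F i (y, h y)) x‖ ≤ ∑ j, C₁ j :=
        e1.trans (Finset.single_le_sum (fun j _ => hC₁0 j) (Finset.mem_univ i))
      -- second piece: every splitting term is bounded by `C₂ R`
      have e2 : ∀ p ∈ splittings v,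
          ‖(ContinuousLinearMap.id ℝ (J →L[ℝ] G)) (cwd p.1 (fun y => dP F (y, h y)) x)
            (cwd p.2 (cwd [i] h) x)‖ ≤ C₂ * Rp := by
        intro p hp
        have hlen := length_add_length_of_mem_splittings hp
        have ha : p.1.length ≤ m := by omega
        have hc : p.2.length + 1 ≤ m + 1 := by omega
        rw [ContinuousLinearMap.id_apply]
        refine (ContinuousLinearMap.le_opNorm _ _).trans (mul_le_mul (hC₂ h hh hbdm p.1 ha x hx)
          ?_ (norm_nonneg _) hC₂0)
        rw [← cwd_append]
        exact hbd (p.2 ++ [i]) (by simpa using hc) x hx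
      have e3 : ‖((splittings v).map fun p =>
          (ContinuousLinearMap.id ℝ (J →L[ℝ] G)) (cwd p.1 (fun y => dP F (y, h y)) x)
            (cwd p.2 (cwd [i] h) x)).sum‖ ≤ 2 ^ m * (C₂ * Rp) := by
        refine (norm_list_sum_le _).trans ?_
        rw [List.map_map]
        have hlen : (splittings v).length ≤ 2 ^ m := by
          rw [length_splittings]
          exact Nat.pow_le_pow_right (by norm_num) hv
        calc ((splittings v).map (Norm.norm ∘ fun p =>
              (ContinuousLinearMap.id ℝ (J →L[ℝ] G)) (cwd p.1 (fun y => dP F (y, h y)) x)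
                (cwd p.2 (cwd [i] h) x))).sum
            ≤ ((splittings v).map fun _ => C₂ * Rp).sum := by
              refine List.sum_le_sum fun p hp => ?_
              exact e2 p hp
          _ = (splittings v).length * (C₂ * Rp) := by
              rw [List.map_const', List.sum_replicate, nsmul_eq_mul]
          _ ≤ 2 ^ m * (C₂ * Rp) := by
              have : (0 : ℝ) ≤ C₂ * Rp := mul_nonneg hC₂0 hRp
              exact mul_le_mul_of_nonneg_right (by exact_mod_cast hlen) this
      calc ‖cwd v (fun y => dX F i (y, h y)) x + ((splittings v).map fun p =>
              (ContinuousLinearMap.id ℝ (J →L[ℝ] G)) (cwd p.1 (fun y => dP F (y, h y)) x)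
                (cwd p.2 (cwd [i] h) x)).sum‖
          ≤ ‖cwd v (fun y => dX F i (y, h y)) x‖ + ‖((splittings v).map fun p =>
              (ContinuousLinearMap.id ℝ (J →L[ℝ] G)) (cwd p.1 (fun y => dP F (y, h y)) x)
                (cwd p.2 (cwd [i] h) x)).sum‖ := norm_add_le _ _
        _ ≤ (∑ j, C₁ j) + 2 ^ m * (C₂ * Rp) := add_le_add e1' e3
        _ ≤ C₀ + (∑ j, C₁ j) + 2 ^ m * (C₂ * Rp) := by linarith

end Sup

/-! ### Tame `L²(K)` bounds for word derivatives of `F(x, h x)` -/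

section Tame

variable {J : Type u} [NormedAddCommGroup J] [NormedSpace ℝ J] [FiniteDimensional ℝ J]

omit [DecidableEq ι] in
/-- **Tame `L²(K)` bounds for word derivatives of a composition** (Taylor, *PDE III*, Ch. 13,
§3, crude Moser estimate): for `F` smooth on `ℝⁿ × J` (`J` finite-dimensional), `K` compact, an
order `m` and a radius `R` there is `C ≥ 0` such that for every smooth `h` with
`‖∂_c h‖ ≤ R` on `K` for `|c| ≤ m / 2 + 1` and every `Y ≥ 0` with `‖𝟙_K ∂_c h‖_{L²} ≤ Y` for
`|c| ≤ m`: `‖𝟙_K ∂_v [F(·, h)]‖_{L²} ≤ C (1 + Y)` for all `|v| ≤ m` — linear in the top-order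
quantity `Y`. Proof: induction on `m` through the one-step chain rule and the Leibniz expansion,
the factor with at most half the derivatives being estimated in the sup norm
(`exists_sup_bound_cwd_comp`). [cite: TaylorPDEIII2011, Ch. 13, §3, Prop. 3.7] -/
theorem exists_tame_bound_cwd_comp (m : ℕ) :
    ∀ {G : Type u} [NormedAddCommGroup G] [NormedSpace ℝ G] {F : EuclideanSpace ℝ ι × J → G},
      ContDiff ℝ ∞ F → ∀ {K : Set (EuclideanSpace ℝ ι)}, IsCompact K → ∀ R : ℝ,
      ∃ C : ℝ, 0 ≤ C ∧ ∀ h : EuclideanSpace ℝ ι → J, ContDiff ℝ ∞ h →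
        (∀ c : List ι, c.length ≤ m / 2 + 1 → ∀ x ∈ K, ‖cwd c h x‖ ≤ R) →
        ∀ Y : ℝ, 0 ≤ Y → (∀ c : List ι, c.length ≤ m → l2On K (cwd c h) ≤ Y) →
        ∀ v : List ι, v.length ≤ m → l2On K (cwd v (fun y => F (y, h y))) ≤ C * (1 + Y) := by
  induction m with
  | zero =>
    intro G _ _ F hF K hK R
    obtain ⟨C, hC0, hC⟩ := exists_sup_bound_comp_graph_zero hF.continuous hK R
    refine ⟨((volume K) ^ (2 : ℝ)⁻¹).toReal * C, by positivity, fun h _ hh Y hY _ v hv => ?_⟩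
    have hv0 : v = [] := List.eq_nil_of_length_eq_zero (Nat.le_zero.1 hv)
    subst hv0
    have hb : ∀ x ∈ K, ‖cwd [] (fun y => F (y, h y)) x‖ ≤ C :=
      fun x hx => hC h (fun y hy => by simpa using hh [] (by norm_num) y hy) x hx
    calc l2On K (cwd [] fun y => F (y, h y)) ≤ ((volume K) ^ (2 : ℝ)⁻¹).toReal * C :=
          l2On_le_of_bound hK hC0 hb
      _ ≤ ((volume K) ^ (2 : ℝ)⁻¹).toReal * C * (1 + Y) :=
          le_mul_of_one_le_right (by positivity) (by linarith)
  | succ m ih =>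
    intro G _ _ F hF K hK R
    -- work with the nonnegative radius `Rp = max R 0`
    set Rp : ℝ := max R 0 with hRpdef
    have hRp : 0 ≤ Rp := le_max_right _ _
    -- the sup-norm order at level `m + 1`
    set q : ℕ := (m + 1) / 2 + 1 with hq
    have hqm : m / 2 + 1 ≤ q := by omega
    -- (0) tame bound at order `m` for `F` itself (short words)
    obtain ⟨C₀, hC₀0, hC₀⟩ := ih hF hK Rp
    -- (1) tame bound at order `m` for `x ↦ dX F i (x, h x)`
    have hX : ∀ i : ι, ∃ C : ℝ, 0 ≤ C ∧ ∀ h : EuclideanSpace ℝ ι → J, ContDiff ℝ ∞ h →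
        (∀ c : List ι, c.length ≤ m / 2 + 1 → ∀ x ∈ K, ‖cwd c h x‖ ≤ Rp) →
        ∀ Y : ℝ, 0 ≤ Y → (∀ c : List ι, c.length ≤ m → l2On K (cwd c h) ≤ Y) →
        ∀ v : List ι, v.length ≤ m →
          l2On K (cwd v (fun y => dX F i (y, h y))) ≤ C * (1 + Y) :=
      fun i => ih (contDiff_dX hF i) hK Rp
    choose C₁ hC₁0 hC₁ using hX
    -- (2) tame bound at order `m` for `x ↦ dP F (x, h x)`
    obtain ⟨C₂, hC₂0, hC₂⟩ := ih (contDiff_dP hF) hK Rp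
    -- (3) sup bound at order `q` for `x ↦ dP F (x, h x)`
    obtain ⟨C₃, hC₃0, hC₃⟩ := exists_sup_bound_cwd_comp (J := J) q (contDiff_dP hF) hK Rp
    have hsum0 : 0 ≤ ∑ i, C₁ i := Finset.sum_nonneg fun i _ => hC₁0 i
    refine ⟨C₀ + (∑ i, C₁ i) + 2 ^ m * (C₃ + C₂ * Rp), by positivity, ?_⟩
    intro h hh hbd Y hY hYb v hv
    -- hypotheses in the `Rp` form and at the lower orders
    have hbq : ∀ c : List ι, c.length ≤ q → ∀ x ∈ K, ‖cwd c h x‖ ≤ Rp :=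
      fun c hc x hx => (hbd c hc x hx).trans (le_max_left _ _)
    have hbm : ∀ c : List ι, c.length ≤ m / 2 + 1 → ∀ x ∈ K, ‖cwd c h x‖ ≤ Rp :=
      fun c hc => hbq c (hc.trans hqm)
    have hYm : ∀ c : List ι, c.length ≤ m → l2On K (cwd c h) ≤ Y :=
      fun c hc => hYb c (hc.trans (Nat.le_succ m))
    have hY1 : 0 ≤ 1 + Y := by linarith
    -- short words
    rcases Nat.lt_or_ge v.length (m + 1) with hvm | hvm
    · have h0 := hC₀ h hh hbm Y hY hYm v (Nat.lt_succ_iff.1 hvm)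
      have : C₀ * (1 + Y) ≤ (C₀ + (∑ i, C₁ i) + 2 ^ m * (C₃ + C₂ * Rp)) * (1 + Y) := by
        apply mul_le_mul_of_nonneg_right _ hY1
        have : 0 ≤ 2 ^ m * (C₃ + C₂ * Rp) := by positivity
        linarith
      exact h0.trans this
    -- words of full length `m + 1`: split off the innermost letter
    have hvl : v.length = m + 1 := le_antisymm hv hvm
    rcases v.eq_nil_or_concat with rfl | ⟨v, i, rfl⟩
    · simp at hvl
    simp only [List.concat_eq_append, List.length_append, List.length_singleton,
      Nat.add_right_cancel_iff] at hvl ⊢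
    rw [cwd_append_singleton]
    have hsplit : (fun y => fderiv ℝ (fun z => F (z, h z)) y (bv i)) =
        fun y => dX F i (y, h y) +
          (ContinuousLinearMap.id ℝ (J →L[ℝ] G)) (dP F (y, h y)) (cwd [i] h y) := by
      have := cwd_singleton_comp_graph hF hh i
      rwa [cwd_singleton] at this
    rw [hsplit]
    have hA : ContDiff ℝ ∞ fun y => dX F i (y, h y) := contDiff_comp_graph (contDiff_dX hF i) hh
    have hP : ContDiff ℝ ∞ fun y => dP F (y, h y) := contDiff_comp_graph (contDiff_dP hF) hh
    have hci : ContDiff ℝ ∞ (cwd [i] h) := contDiff_cwd hh [i]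
    have hB : ContDiff ℝ ∞ fun y =>
        (ContinuousLinearMap.id ℝ (J →L[ℝ] G)) (dP F (y, h y)) (cwd [i] h y) :=
      contDiff_bilinear_apply _ hP hci
    rw [cwd_fun_add hA hB, cwd_bilinear _ hP hci]
    -- the term map of the Leibniz expansion
    set Φ : List ι × List ι → EuclideanSpace ℝ ι → G := fun p x =>
      (ContinuousLinearMap.id ℝ (J →L[ℝ] G)) (cwd p.1 (fun y => dP F (y, h y)) x)
        (cwd p.2 (cwd [i] h) x) with hΦ
    have hΦc : ∀ p ∈ splittings v, Continuous (Φ p) := fun p _ =>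
      (contDiff_bilinear_apply _ (contDiff_cwd hP p.1) (contDiff_cwd hci p.2)).continuous
    -- (i) the first piece
    have e1 : l2On K (cwd v fun y => dX F i (y, h y)) ≤ (∑ j, C₁ j) * (1 + Y) := by
      refine (hC₁ i h hh hbm Y hY hYm v hvl.le).trans ?_
      exact mul_le_mul_of_nonneg_right
        (Finset.single_le_sum (fun j _ => hC₁0 j) (Finset.mem_univ i)) hY1
    -- (ii) each Leibniz term
    have e2 : ∀ p ∈ splittings v, l2On K (Φ p) ≤ (C₃ + C₂ * Rp) * (1 + Y) := by
      intro p hp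
      have hlen := length_add_length_of_mem_splittings hp
      rw [hvl] at hlen
      have happ : cwd p.2 (cwd [i] h) = cwd (p.2 ++ [i]) h := (cwd_append p.2 [i] h).symm
      rcases le_or_gt p.1.length p.2.length with hle | hgt
      · -- few derivatives on the nonlinear factor: sup × L²
        have ha : p.1.length ≤ q := by omega
        have hpt : ∀ x ∈ K, ‖Φ p x‖ ≤ C₃ * ‖cwd (p.2 ++ [i]) h x‖ := by
          intro x hx
          simp only [hΦ, ContinuousLinearMap.id_apply, happ]
          exact (ContinuousLinearMap.le_opNorm _ _).trans
            (mul_le_mul_of_nonneg_right (hC₃ h hh hbq p.1 ha x hx) (norm_nonneg _))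
        have hY' : l2On K (cwd (p.2 ++ [i]) h) ≤ Y := hYb _ (by simp; omega)
        calc l2On K (Φ p) ≤ C₃ * l2On K (cwd (p.2 ++ [i]) h) :=
              l2On_le_mul_of_le hK (continuous_cwd hh _) hC₃0 hpt
          _ ≤ C₃ * (1 + Y) := mul_le_mul_of_nonneg_left (by linarith) hC₃0
          _ ≤ (C₃ + C₂ * Rp) * (1 + Y) := by
              apply mul_le_mul_of_nonneg_right _ hY1
              have : 0 ≤ C₂ * Rp := mul_nonneg hC₂0 hRp
              linarith
      · -- many derivatives on the nonlinear factor: L² × sup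
        have hc : (p.2 ++ [i]).length ≤ q := by simp; omega
        have hpt : ∀ x ∈ K, ‖Φ p x‖ ≤ Rp * ‖cwd p.1 (fun y => dP F (y, h y)) x‖ := by
          intro x hx
          simp only [hΦ, ContinuousLinearMap.id_apply, happ]
          rw [mul_comm]
          exact (ContinuousLinearMap.le_opNorm _ _).trans
            (mul_le_mul_of_nonneg_left (hbq _ hc x hx) (norm_nonneg _))
        have ha : p.1.length ≤ m := by omega
        calc l2On K (Φ p) ≤ Rp * l2On K (cwd p.1 fun y => dP F (y, h y)) :=
              l2On_le_mul_of_le hK (continuous_cwd hP _) hRp hpt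
          _ ≤ Rp * (C₂ * (1 + Y)) :=
              mul_le_mul_of_nonneg_left (hC₂ h hh hbm Y hY hYm p.1 ha) hRp
          _ = C₂ * Rp * (1 + Y) := by ring
          _ ≤ (C₃ + C₂ * Rp) * (1 + Y) := by
              apply mul_le_mul_of_nonneg_right _ hY1
              linarith
    -- (iii) sum of the Leibniz terms
    have e3 : l2On K (fun x => ((splittings v).map fun p => Φ p x).sum) ≤
        2 ^ m * ((C₃ + C₂ * Rp) * (1 + Y)) := by
      refine (l2On_list_sum_le hK (splittings v) hΦc).trans ?_
      calc ((splittings v).map fun p => l2On K (Φ p)).sum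
          ≤ ((splittings v).map fun _ => (C₃ + C₂ * Rp) * (1 + Y)).sum :=
            List.sum_le_sum fun p hp => e2 p hp
        _ = (splittings v).length * ((C₃ + C₂ * Rp) * (1 + Y)) := by
            rw [List.map_const', List.sum_replicate, nsmul_eq_mul]
        _ = 2 ^ m * ((C₃ + C₂ * Rp) * (1 + Y)) := by
            rw [length_splittings, hvl]
            push_cast
            ring
    -- (iv) assemble
    have hsumc : Continuous fun x => ((splittings v).map fun p => Φ p x).sum :=
      continuous_list_sum _ hΦc
    calc l2On K (fun x => cwd v (fun y => dX F i (y, h y)) x +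
          ((splittings v).map fun p => Φ p x).sum)
        ≤ l2On K (cwd v fun y => dX F i (y, h y)) +
          l2On K (fun x => ((splittings v).map fun p => Φ p x).sum) :=
          l2On_add_le hK (continuous_cwd hA v) hsumc
      _ ≤ (∑ j, C₁ j) * (1 + Y) + 2 ^ m * ((C₃ + C₂ * Rp) * (1 + Y)) := add_le_add e1 e3
      _ ≤ (C₀ + (∑ i, C₁ i) + 2 ^ m * (C₃ + C₂ * Rp)) * (1 + Y) := by
          have : 0 ≤ C₀ * (1 + Y) := mul_nonneg hC₀0 hY1
          nlinarith

end Tame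

end Literature.Analysis.PDE

end
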